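import Mathlib
import Summits.ValiantsHypothesis.ValiantsHypothesis.Theorems.NewtonUnitEquationsDissociatedUniformTotalsLawBinaryRuns
import Summits.ValiantsHypothesis.ValiantsHypothesis.Theorems.NewtonUnitEquationsDissociatedUniformTotalsLawBinaryCharts
import HarnessLib

/-!
# Crux `NewtonUnitEquations.DissociatedUniform` (stmt-ValiantsHypothesis-5905): totals law, the binary row — the fine generic sample

Third tool file for the `q = 2` row of the typed general totals law `TotalsLawN.TotalsLawGeneral` (companions
`…TotalsLawBinaryRuns`, `…TotalsLawBinaryCharts`; memo `Cruxes/DissociatedUniform/NOTES-t1.md` §5(iv), crit-3 S2).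
Kinetic set-up along one affine chart `t ↦ (σ, t)` of weights for the subset sums of `v : Fin (m+1) → ℝ²`:
* `tops v σ e` — the chart tops of the parity class `e`; each is a strict top at some GENERIC time (`wit`, off the finite
  event set of `…BinaryCharts`), and all these witness times together with the midpoints of consecutive events form the finite
  generic SAMPLE `samples v σ`, which is FINE: two distinct events are separated by a sample (`exists_sample_between`), so two
  consecutive samples enclose at most one event (`events_eq_of_between`).
* `flips v σ p s` — the indices whose sign `ℓ_i > 0` differs at `p` and at `s`.  Between CONSECUTIVE samples all flipping indices
  vanish at one common event, and every minimiser of `|ℓ_i|` at either sample flips or is chart-null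
  (`mem_flips_or_null_of_mem_Amin_left/right`: otherwise a crossing time of two non-identical `|ℓ|`'s — an event — would sit
  strictly between the sample and the root, by the intermediate value theorem).
* `card_flips_filter_reps_le_one`: at most one REPRESENTATIVE `i₀(sample)` flips between consecutive samples (two indices vanishing
  at the same event have proportional `|ℓ|`'s, and the steeper one is never a strict minimiser).
[folklore: extreme points of the hull of a finite set lie in the set]
-/

set_option linter.dupNamespace false -- `ValiantsHypothesis.ValiantsHypothesis` (summit = problem) in every name

open scoped Classical BigOperators
open Finset Matrix
open Literature.Computability.AlgebraicComplexity.KPTT.PlanarMinkowski (IsStrictTop)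

namespace Summit.ValiantsHypothesis.ValiantsHypothesis.Theorems.NewtonUnitEquationsDissociatedUniform

namespace TotalsLawN

namespace Binary

variable {m : ℕ}

/-! ### Chart tops, generic witnesses, the sample -/

/-- The chart tops of the parity class `e` along the half-chart `t ↦ (σ, t)`. -/
noncomputable def tops (v : Fin (m + 1) → (Fin 2 → ℝ)) (σ : ℝ) (e : ZMod 2) : Finset (Fin 2 → ℝ) :=
  (cls v e).filter fun x => ∃ t : ℝ, IsStrictTop ![σ, t] (cls v e) x

/-- A chart top is a strict top at some GENERIC (non-event) time: strict tops are stable under small changes of `t`, and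
the events are finitely many. [folklore] -/
theorem exists_generic_time {v : Fin (m + 1) → (Fin 2 → ℝ)} {σ : ℝ} {e : ZMod 2} {x : Fin 2 → ℝ}
    (hx : x ∈ tops v σ e) : ∃ t : ℝ, t ∉ events v σ ∧ IsStrictTop ![σ, t] (cls v e) x := by
  obtain ⟨-, t₀, ht₀⟩ := Finset.mem_filter.1 hx
  obtain ⟨ε, hε, hpert⟩ := ht₀.exists_perturb_chart
  have hinf : (Set.Ioo (t₀ - ε) (t₀ + ε) \ (events v σ : Set ℝ)).Infinite :=
    (Set.Ioo_infinite (by linarith)).sdiff (events v σ).finite_toSet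
  obtain ⟨t, ht, htZ⟩ := hinf.nonempty
  exact ⟨t, htZ, hpert t (by rw [abs_le]; constructor <;> linarith [ht.1, ht.2])⟩

/-- A generic witness time for a chart top (and `0` for non-tops). -/
noncomputable def wit (v : Fin (m + 1) → (Fin 2 → ℝ)) (σ : ℝ) (e : ZMod 2) (x : Fin 2 → ℝ) : ℝ :=
  if h : ∃ t : ℝ, t ∉ events v σ ∧ IsStrictTop ![σ, t] (cls v e) x then h.choose else 0

/-- The witness time of a chart top is generic and exposes it. [folklore] -/
theorem wit_spec {v : Fin (m + 1) → (Fin 2 → ℝ)} {σ : ℝ} {e : ZMod 2} {x : Fin 2 → ℝ} (hx : x ∈ tops v σ e) :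
    wit v σ e x ∉ events v σ ∧ IsStrictTop ![σ, wit v σ e x] (cls v e) x := by
  have h := exists_generic_time hx
  rw [wit, dif_pos h]
  exact h.choose_spec

/-- The SAMPLE: all witness times of chart tops and all midpoints of pairs of events, as far as they are generic. -/
noncomputable def samples (v : Fin (m + 1) → (Fin 2 → ℝ)) (σ : ℝ) : Finset ℝ :=
  ((univ.biUnion fun e : ZMod 2 => (tops v σ e).image (wit v σ e)) ∪
    ((events v σ ×ˢ events v σ).image fun p : ℝ × ℝ => (p.1 + p.2) / 2)).filter fun t => t ∉ events v σ

/-- Samples are generic. [folklore] -/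
theorem not_mem_events_of_mem_samples {v : Fin (m + 1) → (Fin 2 → ℝ)} {σ s : ℝ} (hs : s ∈ samples v σ) :
    s ∉ events v σ :=
  (Finset.mem_filter.1 hs).2

/-- Witness times are samples. [folklore] -/
theorem wit_mem_samples {v : Fin (m + 1) → (Fin 2 → ℝ)} {σ : ℝ} {e : ZMod 2} {x : Fin 2 → ℝ} (hx : x ∈ tops v σ e) :
    wit v σ e x ∈ samples v σ :=
  Finset.mem_filter.2 ⟨Finset.mem_union.2 (Or.inl (Finset.mem_biUnion.2
    ⟨e, mem_univ _, Finset.mem_image.2 ⟨x, hx, rfl⟩⟩)), (wit_spec hx).1⟩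

/-- **Fineness.** Two distinct events are separated by a sample. [folklore] -/
theorem exists_sample_between {v : Fin (m + 1) → (Fin 2 → ℝ)} {σ e₁ e₂ : ℝ} (h₁ : e₁ ∈ events v σ)
    (h₂ : e₂ ∈ events v σ) (hlt : e₁ < e₂) : ∃ u ∈ samples v σ, e₁ < u ∧ u < e₂ := by
  set Z' := (events v σ).filter fun z => e₁ < z with hZ'
  have hne : Z'.Nonempty := ⟨e₂, Finset.mem_filter.2 ⟨h₂, hlt⟩⟩
  have he₃ : Z'.min' hne ∈ Z' := Finset.min'_mem _ _
  have h13 : e₁ < Z'.min' hne := (Finset.mem_filter.1 he₃).2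
  have h32 : Z'.min' hne ≤ e₂ := Finset.min'_le _ _ (Finset.mem_filter.2 ⟨h₂, hlt⟩)
  refine ⟨(e₁ + Z'.min' hne) / 2, Finset.mem_filter.2 ⟨Finset.mem_union.2 (Or.inr (Finset.mem_image.2
    ⟨(e₁, Z'.min' hne), Finset.mem_product.2 ⟨h₁, (Finset.mem_filter.1 he₃).1⟩, rfl⟩)), fun hmem => ?_⟩,
    by linarith, by linarith⟩
  have : Z'.min' hne ≤ (e₁ + Z'.min' hne) / 2 := Finset.min'_le _ _ (Finset.mem_filter.2 ⟨hmem, by linarith⟩)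
  linarith

/-- Two consecutive samples enclose at most one event. [folklore] -/
theorem events_eq_of_between {v : Fin (m + 1) → (Fin 2 → ℝ)} {σ p s : ℝ} (hps : IsPred (samples v σ) p s)
    {e₁ e₂ : ℝ} (h₁ : e₁ ∈ events v σ) (h₂ : e₂ ∈ events v σ) (hp₁ : p < e₁) (hs₁ : e₁ < s) (hp₂ : p < e₂)
    (hs₂ : e₂ < s) : e₁ = e₂ := by
  by_contra hne
  rcases lt_or_gt_of_ne hne with hlt | hlt
  · obtain ⟨u, hu, hu₁, hu₂⟩ := exists_sample_between h₁ h₂ hlt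
    exact hps.2.2 u hu ⟨hp₁.trans hu₁, hu₂.trans hs₂⟩
  · obtain ⟨u, hu, hu₁, hu₂⟩ := exists_sample_between h₂ h₁ hlt
    exact hps.2.2 u hu ⟨hp₂.trans hu₁, hu₂.trans hs₁⟩

/-! ### Flips between two times -/

/-- The indices whose sign `ℓ_i > 0` differs at the times `p` and `s`. -/
noncomputable def flips (v : Fin (m + 1) → (Fin 2 → ℝ)) (σ p s : ℝ) : Finset (Fin (m + 1)) :=
  univ.filter fun i => ¬ (i ∈ J v σ p ↔ i ∈ J v σ s)

/-- Membership in `flips`. [folklore] -/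
theorem mem_flips {v : Fin (m + 1) → (Fin 2 → ℝ)} {σ p s : ℝ} {i : Fin (m + 1)} :
    i ∈ flips v σ p s ↔ ¬ (i ∈ J v σ p ↔ i ∈ J v σ s) := by
  simp [flips]

/-- No flips: the sign pattern is unchanged. [folklore] -/
theorem J_eq_of_flips_eq_empty {v : Fin (m + 1) → (Fin 2 → ℝ)} {σ p s : ℝ} (h : flips v σ p s = ∅) :
    J v σ s = J v σ p := by
  ext i
  have hi : i ∉ flips v σ p s := by rw [h]; exact Finset.notMem_empty i
  rw [mem_flips, not_not] at hi
  exact hi.symm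

/-- A non-null index vanishing strictly between two generic times flips between them. [folklore] -/
theorem mem_flips_of_root {v : Fin (m + 1) → (Fin 2 → ℝ)} {σ p s e : ℝ} (hp : p ∉ events v σ) (hs : s ∉ events v σ)
    (hpe : p < e) (hes : e < s) {j : Fin (m + 1)} (h0 : ell v σ j e = 0)
    (hnn : ¬ (alpha v σ j = 0 ∧ beta v j = 0)) : j ∈ flips v σ p s := by
  rw [mem_flips, mem_J, mem_J]
  have hbj : beta v j ≠ 0 := by
    intro hb; apply hnn; rw [ell_eq, hb, mul_zero, add_zero] at h0; exact ⟨h0, hb⟩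
  have hfac : ∀ t, ell v σ j t = beta v j * (t - e) := by
    intro t
    have : alpha v σ j = -(e * beta v j) := by rw [ell_eq] at h0; linarith
    rw [ell_eq, this]; ring
  have hp0 : ell v σ j p ≠ 0 := fun h => hnn (null_of_ell_eq_zero hp h)
  have hs0 : ell v σ j s ≠ 0 := fun h => hnn (null_of_ell_eq_zero hs h)
  rw [hfac] at hp0 hs0 ⊢; rw [hfac]
  rcases lt_or_gt_of_ne hbj with hb | hb
  · have h1 : 0 < beta v j * (p - e) := mul_pos_of_neg_of_neg hb (by linarith)
    have h2 : beta v j * (s - e) < 0 := mul_neg_of_neg_of_pos hb (by linarith)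
    exact fun h => (not_lt.2 h2.le) (h.1 h1)
  · have h1 : beta v j * (p - e) < 0 := mul_neg_of_pos_of_neg hb (by linarith)
    have h2 : 0 < beta v j * (s - e) := mul_pos hb (by linarith)
    exact fun h => (not_lt.2 h1.le) (h.2 h2)

/-- Near a root of `ℓ_i` that is not a root of `ℓ_j`, `|ℓ_i| < |ℓ_j|`. [folklore] -/
theorem exists_nhd_abs_lt {v : Fin (m + 1) → (Fin 2 → ℝ)} {σ e : ℝ} {i j : Fin (m + 1)} (hi : ell v σ i e = 0)
    (hj : ell v σ j e ≠ 0) : ∃ δ : ℝ, 0 < δ ∧ ∀ t : ℝ, |t - e| < δ → |ell v σ i t| < |ell v σ j t| := by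
  refine ⟨|ell v σ j e| / (|beta v i| + |beta v j| + 1), by positivity, fun t ht => ?_⟩
  have hi1 : |ell v σ i t| = |beta v i| * |t - e| := by
    rw [show ell v σ i t = ell v σ i t - ell v σ i e by rw [hi, sub_zero], ell_eq, ell_eq,
      show alpha v σ i + t * beta v i - (alpha v σ i + e * beta v i) = beta v i * (t - e) by ring, abs_mul]
  have hj1 : |ell v σ j e| - |beta v j| * |t - e| ≤ |ell v σ j t| := by
    have h := abs_sub_abs_le_abs_sub (ell v σ j e) (ell v σ j t)
    rw [show ell v σ j e - ell v σ j t = beta v j * (e - t) by rw [ell_eq, ell_eq]; ring, abs_mul,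
      abs_sub_comm] at h
    linarith
  have hkey : (|beta v i| + |beta v j|) * |t - e| < |ell v σ j e| := by
    have h1 : (|beta v i| + |beta v j|) * |t - e| ≤ (|beta v i| + |beta v j|) *
        (|ell v σ j e| / (|beta v i| + |beta v j| + 1)) := mul_le_mul_of_nonneg_left ht.le (by positivity)
    have h2 : (|beta v i| + |beta v j|) * (|ell v σ j e| / (|beta v i| + |beta v j| + 1)) =
        |ell v σ j e| - |ell v σ j e| / (|beta v i| + |beta v j| + 1) := by
      field_simp; ring
    have h3 : 0 < |ell v σ j e| / (|beta v i| + |beta v j| + 1) := by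
      have := abs_pos.2 hj; positivity
    linarith
  rw [hi1]
  nlinarith [hj1, hkey, abs_nonneg (beta v j), abs_nonneg (t - e)]

/-- The `|ℓ|`'s are continuous in `t`. [folklore] -/
theorem continuous_abs_ell (v : Fin (m + 1) → (Fin 2 → ℝ)) (σ : ℝ) (i : Fin (m + 1)) :
    Continuous fun t => |ell v σ i t| := by
  unfold ell; fun_prop

/-- Preparations shared by the two one-sided lemmas: a flipping index `i` with its root `e ∈ (p, s)`, and for a
non-flipping non-null `j`: `ℓ_j(e) ≠ 0` and `i`, `j` are not identical. [folklore] -/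
theorem flip_root_data {v : Fin (m + 1) → (Fin 2 → ℝ)} {σ p s : ℝ} (hps : IsPred (samples v σ) p s)
    (hs : s ∈ samples v σ) {i j : Fin (m + 1)} (hi : i ∈ flips v σ p s) (hjF : j ∉ flips v σ p s)
    (hnn : ¬ (alpha v σ j = 0 ∧ beta v j = 0)) :
    ∃ e : ℝ, e ∈ events v σ ∧ p < e ∧ e < s ∧ ell v σ i e = 0 ∧ ell v σ j e ≠ 0 ∧ ¬ SameV v σ i j := by
  have hp := not_mem_events_of_mem_samples hps.1
  have hs' := not_mem_events_of_mem_samples hs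
  obtain ⟨hbi, hpe, hes, hie⟩ := root_between_of_flip hp hs' hps.2.1 (mem_flips.1 hi)
  have he : -alpha v σ i / beta v i ∈ events v σ := root_mem_events hie fun h => hbi h.2
  have hje : ell v σ j (-alpha v σ i / beta v i) ≠ 0 := fun h0 => hjF (mem_flips_of_root hp hs' hpe hes h0 hnn)
  refine ⟨_, he, hpe, hes, hie, hje, fun hS => hje ?_⟩
  have h := hS.abs_eq (-alpha v σ i / beta v i)
  rw [hie, abs_zero] at h
  exact abs_eq_zero.1 h.symm

/-- **Minimisers at the left sample flip (or are null).**  For consecutive samples `p < s` with a flip, every minimiser of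
`|ℓ|` at `p` flips between `p` and `s` or is chart-null. [folklore] -/
theorem mem_flips_or_null_of_mem_Amin_left {v : Fin (m + 1) → (Fin 2 → ℝ)} {σ p s : ℝ}
    (hps : IsPred (samples v σ) p s) (hs : s ∈ samples v σ) (hF : (flips v σ p s).Nonempty) {j : Fin (m + 1)}
    (hj : j ∈ Amin v σ p) : j ∈ flips v σ p s ∨ (alpha v σ j = 0 ∧ beta v j = 0) := by
  by_contra hcon
  rw [not_or] at hcon
  obtain ⟨i, hi⟩ := hF
  obtain ⟨e, he, hpe, hes, hie, hje, hnS⟩ := flip_root_data hps hs hi hcon.1 hcon.2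
  have hp := not_mem_events_of_mem_samples hps.1
  -- at `p`: `|ℓ_j| < |ℓ_i|`
  have hVp : |ell v σ j p| < |ell v σ i p| :=
    lt_of_le_of_ne (mem_Amin.1 hj i) fun heq => hnS (sameV_of_abs_eq hp heq.symm)
  -- near `e` on the left: `|ℓ_i| < |ℓ_j|`
  obtain ⟨δ, hδ, hnear⟩ := exists_nhd_abs_lt hie hje
  set t₁ := max ((p + e) / 2) (e - δ / 2) with ht₁
  have hpt₁ : p < t₁ := lt_of_lt_of_le (by linarith) (le_max_left _ _)
  have ht₁e : t₁ < e := max_lt (by linarith) (by linarith)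
  have hVt₁ : |ell v σ i t₁| < |ell v σ j t₁| :=
    hnear t₁ (by rw [abs_sub_comm, abs_of_pos (by linarith : (0:ℝ) < e - t₁)]; linarith [le_max_right ((p + e) / 2) (e - δ / 2)])
  -- a crossing strictly between `p` and `t₁`: an event other than `e` inside `(p, s)`
  have hcont : ContinuousOn (fun t => |ell v σ i t| - |ell v σ j t|) (Set.Icc p t₁) :=
    ((continuous_abs_ell v σ i).sub (continuous_abs_ell v σ j)).continuousOn
  have h0 : (0 : ℝ) ∈ Set.Ioo (|ell v σ i t₁| - |ell v σ j t₁|) (|ell v σ i p| - |ell v σ j p|) :=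
    ⟨by linarith, by linarith⟩
  obtain ⟨c, hc, hc0⟩ := intermediate_value_Ioo' hpt₁.le hcont h0
  have hce : c ∈ events v σ := cross_mem_events (sub_eq_zero.1 hc0) hnS
  have hceq : c = e := events_eq_of_between hps hce he hc.1 (hc.2.trans (ht₁e.trans hes)) hpe hes
  linarith [hc.2]

/-- **Minimisers at the right sample flip (or are null).** [folklore] -/
theorem mem_flips_or_null_of_mem_Amin_right {v : Fin (m + 1) → (Fin 2 → ℝ)} {σ p s : ℝ}
    (hps : IsPred (samples v σ) p s) (hs : s ∈ samples v σ) (hF : (flips v σ p s).Nonempty) {j : Fin (m + 1)}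
    (hj : j ∈ Amin v σ s) : j ∈ flips v σ p s ∨ (alpha v σ j = 0 ∧ beta v j = 0) := by
  by_contra hcon
  rw [not_or] at hcon
  obtain ⟨i, hi⟩ := hF
  obtain ⟨e, he, hpe, hes, hie, hje, hnS⟩ := flip_root_data hps hs hi hcon.1 hcon.2
  have hs' := not_mem_events_of_mem_samples hs
  have hVs : |ell v σ j s| < |ell v σ i s| :=
    lt_of_le_of_ne (mem_Amin.1 hj i) fun heq => hnS (sameV_of_abs_eq hs' heq.symm)
  obtain ⟨δ, hδ, hnear⟩ := exists_nhd_abs_lt hie hje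
  set t₁ := min ((s + e) / 2) (e + δ / 2) with ht₁
  have ht₁s : t₁ < s := lt_of_le_of_lt (min_le_left _ _) (by linarith)
  have het₁ : e < t₁ := lt_min (by linarith) (by linarith)
  have hVt₁ : |ell v σ i t₁| < |ell v σ j t₁| :=
    hnear t₁ (by rw [abs_of_pos (by linarith : (0:ℝ) < t₁ - e)]; linarith [min_le_right ((s + e) / 2) (e + δ / 2)])
  have hcont : ContinuousOn (fun t => |ell v σ i t| - |ell v σ j t|) (Set.Icc t₁ s) :=
    ((continuous_abs_ell v σ i).sub (continuous_abs_ell v σ j)).continuousOn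
  have h0 : (0 : ℝ) ∈ Set.Ioo (|ell v σ i t₁| - |ell v σ j t₁|) (|ell v σ i s| - |ell v σ j s|) :=
    ⟨by linarith, by linarith⟩
  obtain ⟨c, hc, hc0⟩ := intermediate_value_Ioo ht₁s.le hcont h0
  have hce : c ∈ events v σ := cross_mem_events (sub_eq_zero.1 hc0) hnS
  have hceq : c = e := events_eq_of_between hps hce he (hpe.trans (het₁.trans hc.1)) hc.2 hpe hes
  linarith [hc.1]

/-! ### Representatives -/

/-- The REPRESENTATIVES: the least minimisers `i₀` at the samples. -/
noncomputable def reps (v : Fin (m + 1) → (Fin 2 → ℝ)) (σ : ℝ) : Finset (Fin (m + 1)) :=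
  (samples v σ).image (i0 v σ)

/-- A representative that is null forces every sample's argmin set to be the null indices; in particular a representative
never vanishes at an event unless it is null — so a FLIPPING index is never identical to a null one. Here: two representatives
vanishing at a common time coincide. [folklore] -/
theorem i0_eq_of_common_root {v : Fin (m + 1) → (Fin 2 → ℝ)} {σ s₁ s₂ e : ℝ} (hs₁ : s₁ ∈ samples v σ)
    (hs₂ : s₂ ∈ samples v σ) (h₁ : ell v σ (i0 v σ s₁) e = 0) (h₂ : ell v σ (i0 v σ s₂) e = 0)
    (hb₁ : beta v (i0 v σ s₁) ≠ 0) (hb₂ : beta v (i0 v σ s₂) ≠ 0) : i0 v σ s₁ = i0 v σ s₂ := by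
  have hg₁ := not_mem_events_of_mem_samples hs₁
  have hg₂ := not_mem_events_of_mem_samples hs₂
  set a := i0 v σ s₁ with ha
  set b := i0 v σ s₂ with hb
  -- both are multiples of `|t - e|`
  have hfa : ∀ t, |ell v σ a t| = |beta v a| * |t - e| := by
    intro t
    rw [show ell v σ a t = ell v σ a t - ell v σ a e by rw [h₁, sub_zero], ell_eq, ell_eq,
      show alpha v σ a + t * beta v a - (alpha v σ a + e * beta v a) = beta v a * (t - e) by ring, abs_mul]
  have hfb : ∀ t, |ell v σ b t| = |beta v b| * |t - e| := by
    intro t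
    rw [show ell v σ b t = ell v σ b t - ell v σ b e by rw [h₂, sub_zero], ell_eq, ell_eq,
      show alpha v σ b + t * beta v b - (alpha v σ b + e * beta v b) = beta v b * (t - e) by ring, abs_mul]
  -- the samples are not the root
  have hs₁e : s₁ ≠ e := by
    intro h; rw [← h] at h₁; exact hb₁ (null_of_ell_eq_zero hg₁ h₁).2
  have hs₂e : s₂ ≠ e := by
    intro h; rw [← h] at h₂; exact hb₂ (null_of_ell_eq_zero hg₂ h₂).2
  have hpos₁ : 0 < |s₁ - e| := abs_pos.2 (sub_ne_zero.2 hs₁e)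
  have hpos₂ : 0 < |s₂ - e| := abs_pos.2 (sub_ne_zero.2 hs₂e)
  -- compare slopes: the flatter one wins strictly at every sample, so both are minimisers at both samples
  have hle₁ : |ell v σ a s₁| ≤ |ell v σ b s₁| := mem_Amin.1 (i0_mem v σ s₁) b
  have hle₂ : |ell v σ b s₂| ≤ |ell v σ a s₂| := mem_Amin.1 (i0_mem v σ s₂) a
  rw [hfa, hfb] at hle₁ hle₂
  have hab : |beta v a| ≤ |beta v b| := le_of_mul_le_mul_right hle₁ hpos₁
  have hba : |beta v b| ≤ |beta v a| := le_of_mul_le_mul_right hle₂ hpos₂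
  have heq : |beta v a| = |beta v b| := le_antisymm hab hba
  -- hence `b` minimises at `s₁` too, and the least minimisers agree
  have hbA : b ∈ Amin v σ s₁ := by
    refine mem_Amin.2 fun k => ?_
    rw [hfb, ← heq, ← hfa]
    exact mem_Amin.1 (i0_mem v σ s₁) k
  exact i0_eq_of_i0_mem hg₁ hg₂ hbA

/-- **At most one representative flips between consecutive samples.** [folklore] -/
theorem card_flips_filter_reps_le_one {v : Fin (m + 1) → (Fin 2 → ℝ)} {σ p s : ℝ}
    (hps : IsPred (samples v σ) p s) (hs : s ∈ samples v σ) :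
    ((flips v σ p s).filter fun i => i ∈ reps v σ).card ≤ 1 := by
  refine Finset.card_le_one.2 fun a ha b hb => ?_
  obtain ⟨haF, har⟩ := Finset.mem_filter.1 ha
  obtain ⟨hbF, hbr⟩ := Finset.mem_filter.1 hb
  obtain ⟨s₁, hs₁, rfl⟩ := Finset.mem_image.1 har
  obtain ⟨s₂, hs₂, rfl⟩ := Finset.mem_image.1 hbr
  have hp := not_mem_events_of_mem_samples hps.1
  have hs' := not_mem_events_of_mem_samples hs
  obtain ⟨hb₁, hp₁, hs₁', he₁⟩ := root_between_of_flip hp hs' hps.2.1 (mem_flips.1 haF)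
  obtain ⟨hb₂, hp₂, hs₂', he₂⟩ := root_between_of_flip hp hs' hps.2.1 (mem_flips.1 hbF)
  have hr₁ := root_mem_events he₁ fun h => hb₁ h.2
  have hr₂ := root_mem_events he₂ fun h => hb₂ h.2
  have hee := events_eq_of_between hps hr₁ hr₂ hp₁ hs₁' hp₂ hs₂'
  rw [hee] at he₁
  exact i0_eq_of_common_root hs₁ hs₂ he₁ he₂ hb₁ hb₂

end Binary

end TotalsLawN

end Summit.ValiantsHypothesis.ValiantsHypothesis.Theorems.NewtonUnitEquationsDissociatedUniform
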